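import Literature.MathematicalPhysics.QuantumFieldTheory.Balaban1983to89.B9SectBL2StepAtLettersV2Right

/-!
# `Balaban1983to89.B9SectBL2StepAtLettersV2Second` — [B9] Sect. B, the two SECOND-ORDER one-sided `L²` members of Theorem 3.1 FOR G′(U′U):
# (3.46)₃ `‖h∇_U∇_UG′(U′U)λ‖` (two differences on the LEFT) and (3.46)₅ `‖hG′(U′U)∇*_U∇*_Uλ‖` (two differences on the RIGHT), PINNED AT THE
# LETTERS AND KERNEL-FREE: ★ `l2secondLeftEntries_ext_of_l2Frame₂`, ★★ `stepL2nPos_three_of_l2Frame₂ : L2Frame₂ … → (readL2_3) → (writeL2_3) →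
# StepL2nPos d c35 geo bg Gp GA Cinv Gp 3`, ★ `l2secondRightEntries_ext_of_l2Frame₂`, ★★ `stepL2nPos_five_of_l2Frame₂ : L2Frame₂ … → (readL2_2) →
# (readL2_5) → (writeL2_5) → StepL2nPos d c35 geo bg Gp GA Cinv Gp 5` — the last two of the six G′ member-steps `B9SectBStepFrameV2.SectBFrame₂`
# displayed (sequel of `B9SectBL2StepAtLettersV2` (members 0, 1), `…V2Right` (member 2), `…V2Mixed` (member 4))

T. Bałaban, *Propagators for lattice gauge theories in a background field*, Commun. Math. Phys. **99** (1985) 389–434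
[`Balaban1985BackgroundPropagators`, "B9"]; [4] = T. Bałaban, *Propagators and renormalization transformations for lattice gauge theories. II*,
Commun. Math. Phys. **96** (1984) 223–250 [`Balaban1984PropagatorsII`].

statement-level skeleton of published theorems with citation tags; proofs where landed; nothing here is a claim about the Yang–Mills mass gap

THE PRINTED LOCUS (verbatim).  Theorem 3.1 (3.46) p. 398: *"Finally, we have the inequalities in L²-norms ‖hG′(U)λ‖, ‖h∇_UG′(U)λ‖, ‖hG′(U)∇*_Uλ‖,
‖h∇_U∇_UG′(U)λ‖, ‖h∇_UG′(U)∇*_Uλ‖, ‖hG′(U)∇*_U∇*_Uλ‖ ≤ B₀[(Lʲη)², Lʲη, Lʲη, 1, 1, 1]|h|e^{−δ₀d(y,y′)}‖λ‖ for supp h ⊂ Δ(y), y ∈ Λ_j, supp λ ⊂ Δ(y′)"*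
— THIS FILE: the fourth and the sixth quantity (prefactor `1`; members `n = 3` and `n = 5` of `B9.KernelFamily.l2` in print's order, as read by the
lit-balaban desk from the page image, ME #18 of the cell's bus); p. 398 (remarks): *"we may always replace ∇_U by ∇*_U and vice versa … Using Lemma
2.1 in [4] we may replace the factor (Lʲη)^α by (Lʲη)^β(L^{j′}η)^γ"*; Theorem 3.4 p. 400 + p. 403 l. 1–9: *"applying Theorem 3.1 for G′(U), the bound
(3.63), the representation (3.64) and Lemma 2.1 of [4] we can prove all the statements (3.42)–(3.47) of Theorem 3.1 for the operator G′(U′U), of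
course with different constants"*; (3.65) p. 402: *"G′(U′U) = G′(U) + G′(U)V′(A)G′(U′U) = G′(U) + G′(U′U)V′(A)G′(U)"*.

WHAT IS IN THE FILE (theorems only; 0 sorry; standard axioms; no new constant — the smallness constants are `B9SectBL2StepAtLettersV2.thetaL2` (left)
and `B9SectBL2StepAtLettersV2Right.thetaL2R` (right), the output rates `(99/100)(49/50)·rate δ₀` (left) and `rateR (rate δ₀)` (right), exactly as for
the first-order members).
* §1 ★ `l2secondLeftEntries_ext_of_l2Frame₂` — for every input (B₀, δ₀): `a₁`, `B` BEFORE the member; at every admissible U, U′ and every PAIR of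
  concrete difference letters: `∇_k∇_lG′(U′U) ≺₂ B·1·e^{−ρ′d}`.  ROUTE = the route of `l2entries_ext_of_l2Frame₂` (members 0, 1) with the left letter
  `X = ∇_k∇_l` and the CONSTANT weight: r06's `thm34_Gp_uniform` (R1) only for the inverse identities (`gop_eq`); the `L²` (3.63)
  `B9Ineq363L2.ineq363_l2_vPrime` from `L2Frame₂.readL2` (members 0, 1 at U); (3.65)₂ by `eq365_of_inverse`; the ℓ²-summed walk
  `hasL2Majorant_leftEntry_gpExt` (generic in the left letter and in the weight) fed with `readL2_3`; smallness `θc₁ ≦ ½` forced by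
  `α₁ ≦ 1/(2(Θc₁ + 1))`.  ★★ `stepL2nPos_three_of_l2Frame₂`.
* §2 ★ `l2secondRightEntries_ext_of_l2Frame₂` — `G′(U′U)∇♯_k∇♯_l ≺₂ B·1·e^{−rateR(δr)d}` per pair.  ROUTE = the route of
  `B9SectBL2StepAtLettersV2Right.l2rightEntries_ext_of_l2Frame₂` (member 2) with the right letter `Y = ∇♯_k∇♯_l` and the constant weight: the left
  composite `B9Ineq363L2Right.hasL2Majorant_gp_vPrime` (from the readings n = 0, 2 at U); (3.65)₁ by `eq365_first_of_inverse`;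
  `hasL2Majorant_rightEntry_gpExt` (generic in the right letter and in the weight) fed with `readL2_5`, the two p. 398 transfers being FREE for a
  constant weight (`B9Ineq366CPrime.scaleTransfer_one`).  ★★ `stepL2nPos_five_of_l2Frame₂`.

THE EXTRA HYPOTHESES (what an instance owes beyond `L2Frame₂`; all pure unfolding of its own `KernelFamily.l2` against `HasL2Majorant` of its
letters): `readL2_3` — the (3.46) block at U ⇒ `∇_k∇_lG′(U) ≺₂ cL·B₀·1·e^{−δd}` for every pair `(k, l)`; `writeL2_3` — `∇_k∇_lG′(U′U) ≺₂ B·1·e^{−ρd}`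
for every pair (letters at the real U) ⇒ the member n = 3 of the family at U′U with `(wL B ρ, wLδ ρ)`; `readL2_2` (as in `…V2Right`); `readL2_5` —
`G′(U)∇♯_k∇♯_l ≺₂ cL·B₀·1·e^{−δd}` per pair; `writeL2_5` — `G′(U′U)∇♯_k∇♯_l ≺₂ B·1·e^{−ρd}` per pair ⇒ the member n = 5 at U′U.  Kept as theorem
hypotheses; `B9SectBStepFrameV4.SectBFrame₄` turns them into fields.  WHICH printed quantity the family's members 3 ∕ 5 are stays the instance's
choice; the desk's reading of p. 398 (print's order) makes n = 3 the ∇∇G′ member and n = 5 the G′∇*∇* member, which is what the majorants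
produced here serve.

HONEST SCOPE.  Hypothesis structure + bookkeeping; Theorem 3.1 at U is the INPUT; nothing of [B9] asserted for Bałaban's propagators; `L2Frame₂` NOT
shown inhabited; count-neutral; NOT a node discharge; nothing continuum ∕ OS ∕ mass-gap ∕ Clay.  Cell `pub-ymgap` (HUMAN RULING D-0062), Track A
node N06 [B9], N06-ASSIGNMENT row 13, seat `pub-ymgap-dag-n06-c` (g5), 2026-08-27.
-/

noncomputable section

open scoped BigOperators

namespace Literature.MathematicalPhysics.QuantumFieldTheory.Balaban1983to89.B9SectBL2StepAtLettersV2Second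

open Literature.MathematicalPhysics.QuantumFieldTheory.Balaban1983to89
open Literature.MathematicalPhysics.QuantumFieldTheory.Balaban1983to89.B6RandomWalk (HasMajorant Triangle254 Ineq261)
open Literature.MathematicalPhysics.QuantumFieldTheory.Balaban1983to89.B6RandomWalkL2 (l2n HasL2Majorant hasL2Majorant_mono)
open Literature.MathematicalPhysics.QuantumFieldTheory.Balaban1983to89.B9Thm34Ext (toB6)
open Literature.MathematicalPhysics.QuantumFieldTheory.Balaban1983to89.B9Ineq347 (ScaleTransfer)
open Literature.MathematicalPhysics.QuantumFieldTheory.Balaban1983to89.B9Eq352DivFormLetters (conj)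
open Literature.MathematicalPhysics.QuantumFieldTheory.Balaban1983to89.B9Eq352GradLetters (diffLetter)
open Literature.MathematicalPhysics.QuantumFieldTheory.Balaban1983to89.B9Eq360Vprime (gPrimeExtEnd)
open Literature.MathematicalPhysics.QuantumFieldTheory.Balaban1983to89.B9Eq360VprimeLetters (vPrimeConc)
open Literature.MathematicalPhysics.QuantumFieldTheory.Balaban1983to89.B9Thm34SectBUniformR1 (thm34_Gp_uniform)
open Literature.MathematicalPhysics.QuantumFieldTheory.Balaban1983to89.B9Thm34GFinal (ineq261_rescale)
open Literature.MathematicalPhysics.QuantumFieldTheory.Balaban1983to89.B9FromB6 (EBlock L2Block)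
open Literature.MathematicalPhysics.QuantumFieldTheory.Balaban1983to89.B9SectBStepWhole (StepPos StepL2nPos)
open Literature.MathematicalPhysics.QuantumFieldTheory.Balaban1983to89.B9SectBGpStepAtLettersV2 (GpFrame₂)
open Literature.MathematicalPhysics.QuantumFieldTheory.Balaban1983to89.B9SectBL2StepAtLettersV2 (L2Frame₂ thetaL2 cVL2_le_one)
open Literature.MathematicalPhysics.QuantumFieldTheory.Balaban1983to89.B9Ineq363L2 (cVL2 cVL2_nonneg ineq363_l2_vPrime eq365_of_inverse
  hasL2Majorant_leftEntry_gpExt hasL2Majorant_rate_mono)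
open Literature.MathematicalPhysics.QuantumFieldTheory.Balaban1983to89.B9Ineq363L2Right (hasL2Majorant_gp_vPrime
  eq365_first_of_inverse hasL2Majorant_rightEntry_gpExt)
open Literature.MathematicalPhysics.QuantumFieldTheory.Balaban1983to89.B9Ineq366CPrime (scaleTransfer_one)
open Literature.MathematicalPhysics.QuantumFieldTheory.Balaban1983to89.B9SectBL2StepAtLettersV2Right (thetaL2R rateR rateR_pos)

universe u

variable {I : Type} {d : ℕ} {c35 : ℝ} {geo : I → B9.Geometry} {bg : I → B9.Backgrounds}
  {Gp : ∀ i, B9.KernelFamily (geo i) (bg i)}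
  {𝔸 : Type u} [NormedRing 𝔸] [NormedAlgebra ℂ 𝔸] [CompleteSpace 𝔸] {ι : Type} [Fintype ι] [DecidableEq ι]
  {b : Module.Basis ι ℝ 𝔸} {κ : Type} [Fintype κ]
  {S : I → Type} [∀ i, Fintype (S i)] [∀ i, DecidableEq (S i)]
  [∀ i, Fintype (geo i).Site] [∀ i, DecidableEq (geo i).Site] [∀ i, Nonempty (geo i).Site]

/-! ## §1  Member 3: two differences on the LEFT (`‖h∇_U∇_UG′(U′U)λ‖`) — (3.65)₂ and the ℓ²-summed walk for the left letter `∇_k∇_l` -/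

/-- ★ **THE LEFT SECOND-ORDER `L²` ENTRIES (3.46)₃ OF G′(U′U) AT THE LETTERS, KERNEL-FREE** — the core of the member-3 step: given, on top of an
`L2Frame₂`, the `L²` READING of member 3 at U for every PAIR of concrete difference letters (`∇_k∇_lG′(U) ≺₂ cL·B₀·1·e^{−δd}`, `k, l ∈ κ ⊕ κ`), for
every input (B₀, δ₀) > 0 there are `a₁ > 0`, `B ≧ 0` (before the member) such that at every (3.35)-regular U above `Mthr δr` with the (3.42) and
(3.46) blocks at (B₀, δ₀) and every U′ in (3.37) at `α₁ ≦ a₁`, every `∇_k∇_lG′(U′U)` carries the block-ℓ² majorant `B·1·e^{−ρ′d}`,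
`ρ′ = (99/100)(49/50)·rate δ₀`.  Proof: r06's `thm34_Gp_uniform` (R1) for the inverse identities (`gop_eq`); the `L²` (3.63)
`B9Ineq363L2.ineq363_l2_vPrime` from the readings n = 0, 1 at U; (3.65)₂ by `eq365_of_inverse`; `hasL2Majorant_leftEntry_gpExt` with the left letter
`X = ∇_k∇_l` and the constant weight; smallness `θc₁ ≦ ½` forced by `α₁ ≦ 1/(2(Θc₁ + 1))`, `Θ = thetaL2 F B₀ δr`.
[cite: Balaban1985BackgroundPropagators, Thm 3.4 p.400 + (3.60)–(3.65) p.402 + p.403 l.1–9 + Thm 3.1 (3.46) p.398; Balaban1984PropagatorsII, Lemma 2.1 p.234 + Prop. 2.6 (2.140)–(2.141) p.247] -/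
theorem l2secondLeftEntries_ext_of_l2Frame₂ (F : L2Frame₂ c35 geo bg Gp b κ S)
    (readL2_3 : ∀ i (α₀ : ℝ) (U : (bg i).Cfg) (B₀ δ : ℝ), F.MInv ≤ (geo i).M → 0 < α₀ → (geo i).M * α₀ ≤ F.aInv →
      (bg i).Reg335 c35 α₀ U → 0 < B₀ → 0 < δ → L2Block (Gp i) B₀ δ U →
      ∀ k l : κ ⊕ κ, HasL2Majorant (g := toB6 (geo i) (F.Rr i) (F.Hp i)) (fun p : S i × ι => F.blk i p.1)
        (conj b (diffLetter (F.T i) (F.coord i U) ((((geo i).eta : ℂ))⁻¹) k) *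
          conj b (diffLetter (F.T i) (F.coord i U) ((((geo i).eta : ℂ))⁻¹) l) * F.Gop i U)
        (fun a a' => F.cL * B₀ * 1 * Real.exp (-(δ * (geo i).dist a a'))))
    {B₀ δ₀ : ℝ} (hB₀ : 0 < B₀) (hδ₀ : 0 < δ₀) :
    ∃ a₁ : ℝ, 0 < a₁ ∧ ∃ B : ℝ, 0 ≤ B ∧
      ∀ (i : I) (α₀ : ℝ) (U : (bg i).Cfg), F.Mthr (F.rate δ₀) ≤ (geo i).M → 0 < α₀ → (geo i).M * α₀ ≤ F.aInv →
        (bg i).Reg335 c35 α₀ U → EBlock (Gp i) B₀ δ₀ U → L2Block (Gp i) B₀ δ₀ U →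
        ∀ (α₁ : ℝ) (U' : (bg i).Cfg), 0 < α₁ → α₁ ≤ a₁ → (bg i).Cplx337 α₁ U U' →
          ∀ k l : κ ⊕ κ, HasL2Majorant (g := toB6 (geo i) (F.Rr i) (F.Hp i)) (fun p : S i × ι => F.blk i p.1)
            (conj b (diffLetter (F.T i) (F.coord i U) ((((geo i).eta : ℂ))⁻¹) k) *
              conj b (diffLetter (F.T i) (F.coord i U) ((((geo i).eta : ℂ))⁻¹) l) * F.Gop i ((bg i).mul U' U))
            (fun a a' => B * 1 * Real.exp (-((1 - 1 / 100) * (49 / 50 * F.rate δ₀) * (geo i).dist a a'))) := by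
  set δr : ℝ := F.rate δ₀ with hδr_def
  have hδr : 0 < δr := F.rate_pos hδ₀
  have hδrc : δr ≤ F.δcap := F.rate_le_cap δ₀
  have hBG : 0 < F.cR * B₀ := mul_pos F.cR_pos hB₀
  have hBL : 0 < F.cL * B₀ := mul_pos F.cL_pos hB₀
  have hSb : 0 ≤ ∑ j, ‖b j‖ := Finset.sum_nonneg fun j _ => norm_nonneg _
  have hSb2 : 0 ≤ Real.sqrt (∑ j, ‖b j‖ ^ 2) := Real.sqrt_nonneg _
  -- r06's uniform clause for G′ (R1) at the call rate (only for the inverse identities of the extension)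
  obtain ⟨a₁, ha₁, B', -, H⟩ := thm34_Gp_uniform b κ (F.d261 δr) δr (F.cR * B₀) F.Cq F.a₀ F.d₀ F.M₂ (F.Λf δr)
    hBG F.Cq_nonneg F.a₀_nonneg F.M₂_nonneg hδr (fun α hα => F.Λf_one_le _ α hδr hα) F.hrepr
  -- the L² smallness constant and the threshold on α₁
  set Θ : ℝ := thetaL2 F B₀ δr with hΘ
  set c₁' : ℝ := B6.c1 (F.d261 δr) (49 / 50 * δr) (1 / 100) with hc₁'
  have hc₁'0 : 0 ≤ c₁' := B6RandomWalk.c1_nonneg _ _ _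
  have hΛ1 : 1 ≤ F.Λf δr (1 / 100) := F.Λf_one_le δr _ hδr (by norm_num)
  have hΛ0 : 0 ≤ F.Λf δr (1 / 100) := zero_le_one.trans hΛ1
  have hΘ0 : 0 ≤ Θ := by
    rw [hΘ, thetaL2]
    have := cVL2_nonneg (d := Fintype.card κ) (nι := Fintype.card ι) (ρu := 1) zero_le_one F.a₀_nonneg F.Cq_nonneg F.M₂_nonneg
      hSb hSb2 (Real.exp_nonneg (δr * F.d₀))
    have := B6RandomWalk.c1_nonneg (F.d261 δr) δr (1 / 100)
    have := F.cL_pos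
    positivity
  have hden : 0 < 2 * (Θ * c₁' + 1) := by positivity
  set a : ℝ := min a₁ (min (1 / 4) (1 / (2 * (Θ * c₁' + 1)))) with ha_def
  have ha0 : 0 < a := lt_min ha₁ (lt_min (by norm_num) (by positivity))
  refine ⟨a, ha0, F.cL * B₀ * c₁' * 2, by positivity, ?_⟩
  intro i α₀ U hM0 hα₀ hMa hU hE hL2 α₁ U' hα₁ ha hU' k l
  have hM : F.MInv ≤ (geo i).M := F.MInv_le_of_Mthr_le hM0
  have ha1 : α₁ ≤ a₁ := ha.trans (min_le_left _ _)
  have haq : α₁ ≤ 1 / 4 := ha.trans ((min_le_right _ _).trans (min_le_left _ _))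
  have haΘ : α₁ ≤ 1 / (2 * (Θ * c₁' + 1)) := ha.trans ((min_le_right _ _).trans (min_le_right _ _))
  have hα1 : α₁ ≤ 1 := haq.trans (by norm_num)
  -- the sup letters at U (for r06) and the inverse identities of the extension
  obtain ⟨hΔG, hGΔ⟩ := F.reg_inv i α₀ U hM hα₀ hMa hU
  obtain ⟨h1, h2, h3, -⟩ := F.read342_le i α₀ U hM hα₀ hMa hU hB₀ hδ₀ (F.rate_le δ₀) hE
  obtain ⟨hkF, hsF, h337s, h337F, h337B, hA, hAτ⟩ := F.cplx i α₁ U U' hα₁ hU'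
  obtain ⟨hinv1, hinv2, -, -⟩ := H (F.T i) (F.coord i U) (F.blk i) (F.kQ i U) (F.sQ i U) (F.cfun i) (F.w i U)
    (F.dist_nonneg i) (F.triangle i) (F.dist_self i) (F.dist_comm i) (F.len_pos i) (F.eta_le_len i) (F.eta_pos i)
    (F.h261_of i hδr hδrc hM0) (F.hST_of i hδr hδrc hM0) (F.unitary i U)
    (F.stencilB i) (F.stencilF i) (F.stencil0 i) (F.w_nonneg i U) (F.card_w i U) (F.hkQ i U) (F.hsQ i U) (F.hcfun i)
    hΔG hGΔ h1 h2 h3 α₁ hα₁.le ha1 (F.expA i U U') (F.kF i U U') (F.sF i U U')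
    hkF hsF h337s h337F h337B hA hAτ
  have hG := F.gop_eq i ((bg i).mul U' U) _ _ (F.mul_law i α₁ U U' hα₁ hU') hinv1 hinv2
  -- the L² readings of Theorem 3.1 at U (members 0, 1 for the L² (3.63); member 3 for the walk's input), lowered to the rates used
  obtain ⟨l0, l1⟩ := F.readL2 i α₀ U B₀ δ₀ hM hα₀ hMa hU hB₀ hδ₀ hL2
  have r3 := readL2_3 i α₀ U B₀ δ₀ hM hα₀ hMa hU hB₀ hδ₀ hL2
  have hw2 : ∀ a : (geo i).Site, 0 ≤ (geo i).len a ^ 2 := fun a => sq_nonneg _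
  have hw1 : ∀ a : (geo i).Site, 0 ≤ (geo i).len a := fun a => (F.len_pos i a).le
  have hw0 : ∀ _a : (geo i).Site, 0 ≤ (1 : ℝ) := fun _ => zero_le_one
  have l0' := hasL2Majorant_rate_mono (R := F.Rr i) (H := F.Hp i) (fun p : S i × ι => F.blk i p.1) (F.cL * B₀)
    (fun a => (geo i).len a ^ 2) hBL.le hw2 (F.rate_le δ₀) (F.dist_nonneg i) l0
  have l1' := fun k => hasL2Majorant_rate_mono (R := F.Rr i) (H := F.Hp i) (fun p : S i × ι => F.blk i p.1) (F.cL * B₀)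
    (fun a => (geo i).len a) hBL.le hw1 (F.rate_le δ₀) (F.dist_nonneg i) (l1 k)
  -- Lemma 2.1 and the scale transfers at the call rate, exponent 1/100 (and (2.61) at the rate 49δr/50 for the walk)
  have h261β : Ineq261 (F.d261 δr) (toB6 (geo i) (F.Rr i) (F.Hp i)) δr (1 / 100) :=
    F.h261_of i hδr hδrc hM0 (1 / 100) (by norm_num) (by norm_num)
  have h261ρ : Ineq261 (F.d261 δr) (toB6 (geo i) (F.Rr i) (F.Hp i)) (49 / 50 * δr) (1 / 100) :=
    ineq261_rescale (F.h261_of i hδr hδrc hM0 (1 / 100 * (49 / 50)) (by norm_num) (by norm_num))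
  obtain ⟨hT1, hT2, -, -, -, -⟩ := F.hST_of i hδr hδrc hM0 (1 / 100) (by norm_num)
  -- the L² (3.63) for the concrete V′(A) at this member
  have hsmall4 : ∀ y : (geo i).Site, (geo i).eta * (α₁ * ((geo i).len y)⁻¹) ≤ 1 / 4 := by
    intro y
    have hl := F.len_pos i y
    have h1 : (geo i).eta * ((geo i).len y)⁻¹ ≤ 1 := by
      rw [← div_eq_mul_inv]; exact (div_le_one hl).mpr (F.eta_le_len i y)
    calc (geo i).eta * (α₁ * ((geo i).len y)⁻¹) = α₁ * ((geo i).eta * ((geo i).len y)⁻¹) := by ring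
      _ ≤ α₁ * 1 := mul_le_mul_of_nonneg_left h1 hα₁.le
      _ ≤ 1 / 4 := by rw [mul_one]; exact haq
  have hr : 49 / 50 * δr + (1 / 100 + 1 / 100) * δr ≤ δr := by nlinarith
  have hW := ineq363_l2_vPrime (Rr := F.Rr i) (H := F.Hp i) b (F.T i) (F.coord i U) (F.blk i) (F.d261 δr) (F.eta_pos i)
    (F.expA i U U') (F.kQ i U) (F.kF i U U') (F.sQ i U) (F.sF i U U') (F.cfun i) (F.w i U) 1 F.d₀ F.M₂ F.Cq F.a₀
    δr δr (1 / 100) (1 / 100) (49 / 50 * δr) (F.Λf δr (1 / 100)) (F.cL * B₀) α₁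
    hBL.le hα₁.le hΛ0 (by positivity) (by norm_num) (by norm_num) hδr.le hδr.le hr
    (F.dist_nonneg i) (F.triangle i) (F.len_pos i) h261β hT1 hT2 F.M₂_nonneg F.hrepr hsmall4
    (fun μ x => ⟨hA μ x, hAτ μ μ x⟩) (fun μ x => h337s μ μ x) (fun μ x => F.unitary i U μ x)
    (fun μ x => ⟨F.stencilF i μ x, F.stencilB i μ x⟩) (F.stencil0 i)
    (F.w_nonneg i U) (F.card_w i U) F.Cq_nonneg F.a₀_nonneg (F.hkQ i U) hkF (F.hsQ i U) hsF (F.hcfun i) l0' l1'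
  -- θ ≤ Θ·α₁ and the smallness θ·c₁(49δr/50, 1/100) ≤ ½
  set θ : ℝ := 2 * (F.cL * B₀) * F.Λf δr (1 / 100) * B6.c1 (F.d261 δr) δr (1 / 100) *
      cVL2 (Fintype.card κ) (Fintype.card ι) 1 α₁ F.a₀ F.Cq F.M₂ (∑ j, ‖b j‖) (Real.sqrt (∑ j, ‖b j‖ ^ 2))
        (Real.exp (δr * F.d₀)) * α₁ with hθ
  have hθ0 : 0 ≤ θ := by
    rw [hθ]
    have := cVL2_nonneg (d := Fintype.card κ) (nι := Fintype.card ι) (ρu := 1) hα₁.le F.a₀_nonneg F.Cq_nonneg F.M₂_nonneg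
      hSb hSb2 (Real.exp_nonneg (δr * F.d₀))
    have := B6RandomWalk.c1_nonneg (F.d261 δr) δr (1 / 100)
    positivity
  have hθΘ : θ ≤ Θ * α₁ := by
    rw [hθ, hΘ, thetaL2]
    have hcv := cVL2_le_one (dκ := Fintype.card κ) (nι := Fintype.card ι) (E₀ := Real.exp (δr * F.d₀)) hα1 F.a₀_nonneg
      F.Cq_nonneg F.M₂_nonneg hSb hSb2 (Real.exp_nonneg _)
    have h0 : 0 ≤ 2 * (F.cL * B₀) * F.Λf δr (1 / 100) * B6.c1 (F.d261 δr) δr (1 / 100) := by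
      have := B6RandomWalk.c1_nonneg (F.d261 δr) δr (1 / 100); positivity
    have := mul_le_mul_of_nonneg_left hcv h0
    exact mul_le_mul_of_nonneg_right this hα₁.le
  have hsmall : θ * c₁' ≤ 1 / 2 := by
    have h1 : θ * c₁' ≤ Θ * c₁' * α₁ := by nlinarith [mul_le_mul_of_nonneg_right hθΘ hc₁'0]
    have h2 : Θ * c₁' * α₁ ≤ Θ * c₁' * (1 / (2 * (Θ * c₁' + 1))) := mul_le_mul_of_nonneg_left haΘ (mul_nonneg hΘ0 hc₁'0)
    have h3 : Θ * c₁' * (1 / (2 * (Θ * c₁' + 1))) ≤ 1 / 2 := by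
      rw [mul_one_div, div_le_iff₀ hden]; nlinarith [mul_nonneg hΘ0 hc₁'0]
    linarith
  have hsmall' : θ * c₁' < 1 := by linarith
  -- (3.65)₂ from the inverse identities; the walk summed in L² for the left letter X = ∇_k∇_l with the constant weight
  have h365 := eq365_of_inverse hΔG hinv2
  have hW' : HasL2Majorant (g := toB6 (geo i) (F.Rr i) (F.Hp i)) (fun p : S i × ι => F.blk i p.1)
      (conj b (vPrimeConc (F.T i) (F.coord i U) (geo i).eta (F.expA i U U') (F.blk i) (F.kQ i U) (F.kF i U U') (F.sQ i U)
        (F.sF i U U') (F.cfun i)) * F.Gop i U)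
      (fun a a' => θ * Real.exp (-(49 / 50 * δr * (geo i).dist a a'))) := by
    simpa only [hθ] using hW
  have hρδr : 49 / 50 * δr ≤ δr := by nlinarith
  have hρδ₀ : 49 / 50 * δr ≤ δ₀ := hρδr.trans (F.rate_le δ₀)
  have r3ρ := hasL2Majorant_rate_mono (R := F.Rr i) (H := F.Hp i) (fun p : S i × ι => F.blk i p.1) (F.cL * B₀)
    (fun _ => (1 : ℝ)) hBL.le hw0 hρδ₀ (F.dist_nonneg i) (r3 k l)
  have hρ0 : 0 ≤ 49 / 50 * δr := by positivity
  have hfactor : F.cL * B₀ * c₁' * (1 - θ * c₁')⁻¹ ≤ F.cL * B₀ * c₁' * 2 := by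
    have hpos : 0 < 1 - θ * c₁' := by linarith
    have : (1 - θ * c₁')⁻¹ ≤ 2 := by
      rw [inv_le_comm₀ hpos (by norm_num : (0 : ℝ) < 2)]; linarith
    exact mul_le_mul_of_nonneg_left this (by positivity)
  have h := hasL2Majorant_leftEntry_gpExt (R := F.Rr i) (H := F.Hp i) (fun p : S i × ι => F.blk i p.1) (F.d261 δr)
    (49 / 50 * δr) (1 / 100) θ (F.cL * B₀) (fun _ => (1 : ℝ)) hBL.le hw0 hθ0 hρ0 (by norm_num)
    (F.triangle i) (F.dist_self i) (F.dist_nonneg i) h261ρ hsmall' h365 (r3ρ) hW'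
  rw [← hG] at h
  refine hasL2Majorant_mono (g := toB6 (geo i) (F.Rr i) (F.Hp i)) _ h fun a a' => ?_
  have he : 0 ≤ (1 : ℝ) * Real.exp (-((1 - 1 / 100) * (49 / 50 * δr) * (geo i).dist a a')) :=
    mul_nonneg zero_le_one (Real.exp_nonneg _)
  calc F.cL * B₀ * B6.c1 (F.d261 δr) (49 / 50 * δr) (1 / 100) * (1 - θ * B6.c1 (F.d261 δr) (49 / 50 * δr) (1 / 100))⁻¹ *
        (1 : ℝ) * Real.exp (-((1 - 1 / 100) * (49 / 50 * δr) * (geo i).dist a a'))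
      = (F.cL * B₀ * c₁' * (1 - θ * c₁')⁻¹) *
        ((1 : ℝ) * Real.exp (-((1 - 1 / 100) * (49 / 50 * δr) * (geo i).dist a a'))) := by rw [hc₁']; ring
    _ ≤ (F.cL * B₀ * c₁' * 2) * ((1 : ℝ) * Real.exp (-((1 - 1 / 100) * (49 / 50 * δr) * (geo i).dist a a'))) :=
        mul_le_mul_of_nonneg_right hfactor he
    _ = _ := by ring

/-- ★★ **THE (3.46)₃-STEP OF SECT. B FOR G′(U′U) (`‖h∇_U∇_UG′(U′U)λ‖`), INHABITED AT THE LETTERS, KERNEL-FREE**: every `L2Frame₂` together with the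
`L²` READING of member 3 at U per pair of concrete difference letters (`readL2_3`) and its WRITING at U′U (`writeL2_3`: block-ℓ² majorants of every
`∇_k∇_lG′(U′U)` at `(B, ρ)` ⇒ the member n = 3 of the family at U′U with the frame's writing functions `(wL B ρ, wLδ ρ)`) inhabits
`B9SectBStepWhole.StepL2nPos d c35 geo bg Gp GA Cinv Gp 3` (output at `ρ′ = (99/100)(49/50)·rate δ₀`) — the fifth of the six G′ member-steps
`B9SectBStepFrameV2.SectBFrame₂` displays, framed from print's own inputs ((3.46) at U, (3.60)–(3.65), [4] Lemma 2.1).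
[cite: Balaban1985BackgroundPropagators, Thm 3.4 p.400 + Thm 3.1 (3.46) p.398 + (3.60)–(3.65) p.402 + p.403 l.1–9; Balaban1984PropagatorsII, Prop. 2.6 (2.140)–(2.141) p.247 + Lemma 2.1 p.234] -/
theorem stepL2nPos_three_of_l2Frame₂ (F : L2Frame₂ c35 geo bg Gp b κ S)
    (readL2_3 : ∀ i (α₀ : ℝ) (U : (bg i).Cfg) (B₀ δ : ℝ), F.MInv ≤ (geo i).M → 0 < α₀ → (geo i).M * α₀ ≤ F.aInv →
      (bg i).Reg335 c35 α₀ U → 0 < B₀ → 0 < δ → L2Block (Gp i) B₀ δ U →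
      ∀ k l : κ ⊕ κ, HasL2Majorant (g := toB6 (geo i) (F.Rr i) (F.Hp i)) (fun p : S i × ι => F.blk i p.1)
        (conj b (diffLetter (F.T i) (F.coord i U) ((((geo i).eta : ℂ))⁻¹) k) *
          conj b (diffLetter (F.T i) (F.coord i U) ((((geo i).eta : ℂ))⁻¹) l) * F.Gop i U)
        (fun a a' => F.cL * B₀ * 1 * Real.exp (-(δ * (geo i).dist a a'))))
    (writeL2_3 : ∀ i (U U' : (bg i).Cfg) (α₁ B δ : ℝ), 0 < α₁ → α₁ ≤ F.aW → (bg i).Cplx337 α₁ U U' → 0 ≤ B → 0 < δ →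
      (∀ k l : κ ⊕ κ, HasL2Majorant (g := toB6 (geo i) (F.Rr i) (F.Hp i)) (fun p : S i × ι => F.blk i p.1)
          (conj b (diffLetter (F.T i) (F.coord i U) ((((geo i).eta : ℂ))⁻¹) k) *
            conj b (diffLetter (F.T i) (F.coord i U) ((((geo i).eta : ℂ))⁻¹) l) * F.Gop i ((bg i).mul U' U))
          (fun a a' => B * 1 * Real.exp (-(δ * (geo i).dist a a')))) →
      ∀ (lam : (geo i).Loc) (h : (geo i).Cut) (y y' : (geo i).Site), (geo i).cutIn h y → (geo i).suppIn lam y' →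
        (Gp i).l2 3 ((bg i).mul U' U) lam h ≤
          F.wL B δ * B9.pref6 ((geo i).len y) 3 * (geo i).cutSup h * Real.exp (-(F.wLδ δ * (geo i).dist y y')) *
            (geo i).l2Norm lam)
    (GA : ∀ i, B9.KernelFamily (geo i) (bg i)) (Cinv : ∀ i, B9.SiteKernel (geo i) (bg i)) :
    StepL2nPos d c35 geo bg Gp GA Cinv Gp 3 := by
  intro B₀ δ₀ Bβ Bε Bεβ B₁ δ₁ hB₀ hδ₀ _ _
  obtain ⟨a₁, ha₁, B, hB, Hc⟩ := l2secondLeftEntries_ext_of_l2Frame₂ F readL2_3 hB₀ hδ₀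
  have hρ' : 0 < (1 - 1 / 100) * (49 / 50 * F.rate δ₀) := by have := F.rate_pos hδ₀; positivity
  refine ⟨F.Mthr (F.rate δ₀), min a₁ F.aW, F.aInv,
    (F.wL B ((1 - 1 / 100) * (49 / 50 * F.rate δ₀)), F.wLδ ((1 - 1 / 100) * (49 / 50 * F.rate δ₀))), F.Mthr_pos _,
    lt_min ha₁ F.aW_pos, F.aInv_pos, ⟨F.wL_pos B _ hB hρ', F.wLδ_pos _ hρ'⟩, ?_⟩
  intro i hM0 α₀ hα₀ hMa U hU hT α₁ hα₁ ha U' hU' lam h y y' hcut hs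
  have e3 := Hc i α₀ U hM0 hα₀ hMa hU hT.1.1.1 hT.1.1.2.1 α₁ U' hα₁ (le_trans ha (min_le_left _ _)) hU'
  exact writeL2_3 i U U' α₁ B _ hα₁ (le_trans ha (min_le_right _ _)) hU' hB hρ' e3 lam h y y' hcut hs

/-! ## §2  Member 5: two differences on the RIGHT (`‖hG′(U′U)∇*_U∇*_Uλ‖`) — (3.65)₁ and the left-routed ℓ²-summed walk for the right letter `∇♯_k∇♯_l` -/

/-- ★ **THE RIGHT SECOND-ORDER `L²` ENTRIES (3.46)₅ OF G′(U′U) AT THE LETTERS, KERNEL-FREE** — the core of the member-5 step: given, on top of an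
`L2Frame₂`, the `L²` READINGS at U of member 2 (`readL2_2`, per difference letter; it feeds the left composite `G′(U)V′(A)`) and of member 5
(`readL2_5`: `G′(U)∇♯_k∇♯_l ≺₂ cL·B₀·1·e^{−δd}` per PAIR of letters), for every input (B₀, δ₀) > 0 there are `a₁ > 0`, `B ≧ 0` (before the member)
such that at every admissible U, U′ every `G′(U′U)∇♯_k∇♯_l` carries the block-ℓ² majorant `B·1·e^{−ρ″d}`, `ρ″ = rateR δr`.  Proof: r06's
`thm34_Gp_uniform` (R1) for the inverse identities (`gop_eq`); `B9Ineq363L2Right.hasL2Majorant_gp_vPrime` (left composite in ℓ², from the readings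
n = 0, 2 at U); (3.65)₁ by `eq365_first_of_inverse`; `hasL2Majorant_rightEntry_gpExt` with the right letter `Y = ∇♯_k∇♯_l`, the constant weight, (2.61)
at the walk's rate and the two p. 398 transfers FREE for a constant weight (`scaleTransfer_one`); smallness `θ_Rc₁ ≦ ½` forced by
`α₁ ≦ 1/(2(Θ_Rc₁ + 1))`, `Θ_R = thetaL2R F B₀ δr`.
[cite: Balaban1985BackgroundPropagators, Thm 3.4 p.400 + (3.60)–(3.65) p.402 + p.403 l.1–9 + Thm 3.1 (3.46) p.398 + p.398 (remarks); Balaban1984PropagatorsII, Lemma 2.1 p.234 + Prop. 2.6 (2.140)–(2.141) p.247] -/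
theorem l2secondRightEntries_ext_of_l2Frame₂ (F : L2Frame₂ c35 geo bg Gp b κ S)
    (readL2_2 : ∀ i (α₀ : ℝ) (U : (bg i).Cfg) (B₀ δ : ℝ), F.MInv ≤ (geo i).M → 0 < α₀ → (geo i).M * α₀ ≤ F.aInv →
      (bg i).Reg335 c35 α₀ U → 0 < B₀ → 0 < δ → L2Block (Gp i) B₀ δ U →
      ∀ k : κ ⊕ κ, HasL2Majorant (g := toB6 (geo i) (F.Rr i) (F.Hp i)) (fun p : S i × ι => F.blk i p.1)
        (F.Gop i U * conj b (diffLetter (F.T i) (F.coord i U) ((((geo i).eta : ℂ))⁻¹) k))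
        (fun a a' => F.cL * B₀ * (geo i).len a * Real.exp (-(δ * (geo i).dist a a'))))
    (readL2_5 : ∀ i (α₀ : ℝ) (U : (bg i).Cfg) (B₀ δ : ℝ), F.MInv ≤ (geo i).M → 0 < α₀ → (geo i).M * α₀ ≤ F.aInv →
      (bg i).Reg335 c35 α₀ U → 0 < B₀ → 0 < δ → L2Block (Gp i) B₀ δ U →
      ∀ k l : κ ⊕ κ, HasL2Majorant (g := toB6 (geo i) (F.Rr i) (F.Hp i)) (fun p : S i × ι => F.blk i p.1)
        (F.Gop i U * conj b (diffLetter (F.T i) (F.coord i U) ((((geo i).eta : ℂ))⁻¹) k) *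
          conj b (diffLetter (F.T i) (F.coord i U) ((((geo i).eta : ℂ))⁻¹) l))
        (fun a a' => F.cL * B₀ * 1 * Real.exp (-(δ * (geo i).dist a a'))))
    {B₀ δ₀ : ℝ} (hB₀ : 0 < B₀) (hδ₀ : 0 < δ₀) :
    ∃ a₁ : ℝ, 0 < a₁ ∧ ∃ B : ℝ, 0 ≤ B ∧
      ∀ (i : I) (α₀ : ℝ) (U : (bg i).Cfg), F.Mthr (F.rate δ₀) ≤ (geo i).M → 0 < α₀ → (geo i).M * α₀ ≤ F.aInv →
        (bg i).Reg335 c35 α₀ U → EBlock (Gp i) B₀ δ₀ U → L2Block (Gp i) B₀ δ₀ U →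
        ∀ (α₁ : ℝ) (U' : (bg i).Cfg), 0 < α₁ → α₁ ≤ a₁ → (bg i).Cplx337 α₁ U U' →
          ∀ k l : κ ⊕ κ, HasL2Majorant (g := toB6 (geo i) (F.Rr i) (F.Hp i)) (fun p : S i × ι => F.blk i p.1)
            (F.Gop i ((bg i).mul U' U) * conj b (diffLetter (F.T i) (F.coord i U) ((((geo i).eta : ℂ))⁻¹) k) *
              conj b (diffLetter (F.T i) (F.coord i U) ((((geo i).eta : ℂ))⁻¹) l))
            (fun a a' => B * 1 * Real.exp (-(rateR (F.rate δ₀) * (geo i).dist a a'))) := by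
  set δr : ℝ := F.rate δ₀ with hδr_def
  have hδr : 0 < δr := F.rate_pos hδ₀
  have hδrc : δr ≤ F.δcap := F.rate_le_cap δ₀
  have hBG : 0 < F.cR * B₀ := mul_pos F.cR_pos hB₀
  have hBL : 0 < F.cL * B₀ := mul_pos F.cL_pos hB₀
  have hSb : 0 ≤ ∑ j, ‖b j‖ := Finset.sum_nonneg fun j _ => norm_nonneg _
  have hSb2 : 0 ≤ Real.sqrt (∑ j, ‖b j‖ ^ 2) := Real.sqrt_nonneg _
  -- r06's uniform clause for G′ (R1) at the call rate (only for the inverse identities of the extension)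
  obtain ⟨a₁, ha₁, B', -, H⟩ := thm34_Gp_uniform b κ (F.d261 δr) δr (F.cR * B₀) F.Cq F.a₀ F.d₀ F.M₂ (F.Λf δr)
    hBG F.Cq_nonneg F.a₀_nonneg F.M₂_nonneg hδr (fun α hα => F.Λf_one_le _ α hδr hα) F.hrepr
  -- the smallness constant and the walk's c₁ (the transfer constants are 1 for the constant weight)
  set Θ : ℝ := thetaL2R F B₀ δr with hΘ
  set c₁' : ℝ := B6.c1 (F.d261 δr) ((1 - 1 / 100) * (49 / 50 * δr)) (1 / 100) with hc₁'
  have hc₁'0 : 0 ≤ c₁' := B6RandomWalk.c1_nonneg _ _ _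
  have hΛ1 : 1 ≤ F.Λf δr (1 / 100) := F.Λf_one_le δr _ hδr (by norm_num)
  have hΛ0 : 0 ≤ F.Λf δr (1 / 100) := zero_le_one.trans hΛ1
  have hΘ0 : 0 ≤ Θ := by
    rw [hΘ, thetaL2R]
    have := cVL2_nonneg (d := Fintype.card κ) (nι := Fintype.card ι) (ρu := 1) zero_le_one F.a₀_nonneg F.Cq_nonneg F.M₂_nonneg
      hSb hSb2 (Real.exp_nonneg (δr * F.d₀))
    have := B6RandomWalk.c1_nonneg (F.d261 δr) δr (1 / 100)
    have := F.cL_pos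
    have := F.M₂_nonneg
    positivity
  have hden : 0 < 2 * (Θ * c₁' + 1) := by positivity
  set a : ℝ := min a₁ (min (1 / 4) (1 / (2 * (Θ * c₁' + 1)))) with ha_def
  have ha0 : 0 < a := lt_min ha₁ (lt_min (by norm_num) (by positivity))
  refine ⟨a, ha0, F.cL * B₀ * 1 * c₁' * 2 * 1, by positivity, ?_⟩
  intro i α₀ U hM0 hα₀ hMa hU hE hL2 α₁ U' hα₁ ha hU' k l
  have hM : F.MInv ≤ (geo i).M := F.MInv_le_of_Mthr_le hM0
  have ha1 : α₁ ≤ a₁ := ha.trans (min_le_left _ _)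
  have haq : α₁ ≤ 1 / 4 := ha.trans ((min_le_right _ _).trans (min_le_left _ _))
  have haΘ : α₁ ≤ 1 / (2 * (Θ * c₁' + 1)) := ha.trans ((min_le_right _ _).trans (min_le_right _ _))
  have hα1 : α₁ ≤ 1 := haq.trans (by norm_num)
  -- the sup letters at U (for r06) and the inverse identities of the extension
  obtain ⟨hΔG, hGΔ⟩ := F.reg_inv i α₀ U hM hα₀ hMa hU
  obtain ⟨h1, h2, h3, -⟩ := F.read342_le i α₀ U hM hα₀ hMa hU hB₀ hδ₀ (F.rate_le δ₀) hE
  obtain ⟨hkF, hsF, h337s, h337F, h337B, hA, hAτ⟩ := F.cplx i α₁ U U' hα₁ hU'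
  obtain ⟨hinv1, hinv2, -, -⟩ := H (F.T i) (F.coord i U) (F.blk i) (F.kQ i U) (F.sQ i U) (F.cfun i) (F.w i U)
    (F.dist_nonneg i) (F.triangle i) (F.dist_self i) (F.dist_comm i) (F.len_pos i) (F.eta_le_len i) (F.eta_pos i)
    (F.h261_of i hδr hδrc hM0) (F.hST_of i hδr hδrc hM0) (F.unitary i U)
    (F.stencilB i) (F.stencilF i) (F.stencil0 i) (F.w_nonneg i U) (F.card_w i U) (F.hkQ i U) (F.hsQ i U) (F.hcfun i)
    hΔG hGΔ h1 h2 h3 α₁ hα₁.le ha1 (F.expA i U U') (F.kF i U U') (F.sF i U U')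
    hkF hsF h337s h337F h337B hA hAτ
  have hG := F.gop_eq i ((bg i).mul U' U) _ _ (F.mul_law i α₁ U U' hα₁ hU') hinv1 hinv2
  -- the L² readings of Theorem 3.1 at U (members 0 and 2 for the left composite; member 5 for the walk's input)
  obtain ⟨l0, -⟩ := F.readL2 i α₀ U B₀ δ₀ hM hα₀ hMa hU hB₀ hδ₀ hL2
  have r2 := readL2_2 i α₀ U B₀ δ₀ hM hα₀ hMa hU hB₀ hδ₀ hL2
  have r5 := readL2_5 i α₀ U B₀ δ₀ hM hα₀ hMa hU hB₀ hδ₀ hL2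
  have hw2 : ∀ a : (geo i).Site, 0 ≤ (geo i).len a ^ 2 := fun a => sq_nonneg _
  have hw1 : ∀ a : (geo i).Site, 0 ≤ (geo i).len a := fun a => (F.len_pos i a).le
  have hw0 : ∀ _a : (geo i).Site, 0 ≤ (1 : ℝ) := fun _ => zero_le_one
  have hρδr : 49 / 50 * δr ≤ δr := by nlinarith
  have hρδ₀ : 49 / 50 * δr ≤ δ₀ := hρδr.trans (F.rate_le δ₀)
  have l0' := hasL2Majorant_rate_mono (R := F.Rr i) (H := F.Hp i) (fun p : S i × ι => F.blk i p.1) (F.cL * B₀)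
    (fun a => (geo i).len a ^ 2) hBL.le hw2 (F.rate_le δ₀) (F.dist_nonneg i) l0
  have r2' := fun k => hasL2Majorant_rate_mono (R := F.Rr i) (H := F.Hp i) (fun p : S i × ι => F.blk i p.1) (F.cL * B₀)
    (fun a => (geo i).len a) hBL.le hw1 (F.rate_le δ₀) (F.dist_nonneg i) (r2 k)
  have r5ρ := hasL2Majorant_rate_mono (R := F.Rr i) (H := F.Hp i) (fun p : S i × ι => F.blk i p.1) (F.cL * B₀)
    (fun _ => (1 : ℝ)) hBL.le hw0 hρδ₀ (F.dist_nonneg i) (r5 k l)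
  -- Lemma 2.1 at the call rate, exponent 1/100; the inverse-weight scale transfers (for the left composite)
  have h261β : Ineq261 (F.d261 δr) (toB6 (geo i) (F.Rr i) (F.Hp i)) δr (1 / 100) :=
    F.h261_of i hδr hδrc hM0 (1 / 100) (by norm_num) (by norm_num)
  obtain ⟨-, -, hT1i, hT2i, -, -⟩ := F.hST_of i hδr hδrc hM0 (1 / 100) (by norm_num)
  -- the left composite G′(U)·V′(A) in L² at this member
  have hsmall4 : ∀ y : (geo i).Site, (geo i).eta * (α₁ * ((geo i).len y)⁻¹) ≤ 1 / 4 := by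
    intro y
    have hl := F.len_pos i y
    have h1 : (geo i).eta * ((geo i).len y)⁻¹ ≤ 1 := by
      rw [← div_eq_mul_inv]; exact (div_le_one hl).mpr (F.eta_le_len i y)
    calc (geo i).eta * (α₁ * ((geo i).len y)⁻¹) = α₁ * ((geo i).eta * ((geo i).len y)⁻¹) := by ring
      _ ≤ α₁ * 1 := mul_le_mul_of_nonneg_left h1 hα₁.le
      _ ≤ 1 / 4 := by rw [mul_one]; exact haq
  have hr : 49 / 50 * δr + (1 / 100 + 1 / 100) * δr ≤ δr := by nlinarith
  have hMV := hasL2Majorant_gp_vPrime (Rr := F.Rr i) (H := F.Hp i) b (F.T i) (F.coord i U) (F.blk i) (F.d261 δr) (F.eta_pos i)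
    (F.expA i U U') (F.kQ i U) (F.kF i U U') (F.sQ i U) (F.sF i U U') (F.cfun i) (F.w i U) 1 F.d₀ F.M₂ F.Cq F.a₀
    δr δr (1 / 100) (1 / 100) (49 / 50 * δr) (F.Λf δr (1 / 100)) (F.cL * B₀) α₁
    hBL.le hα₁.le hΛ0 (by positivity) (by norm_num) (by norm_num) hδr.le hδr.le hr
    (F.dist_nonneg i) (F.triangle i) (F.len_pos i) h261β hT1i hT2i F.M₂_nonneg F.hrepr hsmall4
    (fun μ x => ⟨hA μ x, hAτ μ μ x⟩) (fun μ x => h337s μ μ x) (fun μ x => h337F μ μ x) h337B (fun μ x => F.unitary i U μ x)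
    (fun μ x => ⟨F.stencilF i μ x, F.stencilB i μ x⟩) (F.stencil0 i)
    (F.w_nonneg i U) (F.card_w i U) F.Cq_nonneg F.a₀_nonneg (F.hkQ i U) hkF (F.hsQ i U) hsF (F.hcfun i) l0' r2'
  -- θ_R ≤ Θ·α₁ and the smallness θ_R·c₁ ≤ ½
  set θ : ℝ := F.cL * B₀ * F.Λf δr (1 / 100) * B6.c1 (F.d261 δr) δr (1 / 100) *
      (cVL2 (Fintype.card κ) (Fintype.card ι) 1 α₁ F.a₀ F.Cq F.M₂ (∑ j, ‖b j‖) (Real.sqrt (∑ j, ‖b j‖ ^ 2))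
          (Real.exp (δr * F.d₀)) +
        2 * Fintype.card κ * (2 * (1 : ℝ) ^ 2 * F.M₂ * (∑ j, ‖b j‖) * Real.sqrt ((1 * Fintype.card ι : ℕ) : ℝ) *
          Real.exp (δr * F.d₀))) * α₁ with hθ
  have hcV0 : 0 ≤ cVL2 (Fintype.card κ) (Fintype.card ι) 1 α₁ F.a₀ F.Cq F.M₂ (∑ j, ‖b j‖) (Real.sqrt (∑ j, ‖b j‖ ^ 2))
      (Real.exp (δr * F.d₀)) :=
    cVL2_nonneg (d := Fintype.card κ) (nι := Fintype.card ι) (ρu := 1) hα₁.le F.a₀_nonneg F.Cq_nonneg F.M₂_nonneg hSb hSb2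
      (Real.exp_nonneg (δr * F.d₀))
  have hK0 : 0 ≤ 2 * (Fintype.card κ : ℝ) * (2 * (1 : ℝ) ^ 2 * F.M₂ * (∑ j, ‖b j‖) * Real.sqrt ((1 * Fintype.card ι : ℕ) : ℝ) *
      Real.exp (δr * F.d₀)) := by have := F.M₂_nonneg; positivity
  have hpre0 : 0 ≤ F.cL * B₀ * F.Λf δr (1 / 100) * B6.c1 (F.d261 δr) δr (1 / 100) := by
    have := B6RandomWalk.c1_nonneg (F.d261 δr) δr (1 / 100); positivity
  have hθ0 : 0 ≤ θ := by
    rw [hθ]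
    exact mul_nonneg (mul_nonneg hpre0 (add_nonneg hcV0 hK0)) hα₁.le
  have hθΘ : θ ≤ Θ * α₁ := by
    rw [hθ, hΘ, thetaL2R]
    have hcv := cVL2_le_one (dκ := Fintype.card κ) (nι := Fintype.card ι) (E₀ := Real.exp (δr * F.d₀)) hα1 F.a₀_nonneg
      F.Cq_nonneg F.M₂_nonneg hSb hSb2 (Real.exp_nonneg _)
    have hsum := add_le_add hcv
      (le_refl (2 * (Fintype.card κ : ℝ) * (2 * (1 : ℝ) ^ 2 * F.M₂ * (∑ j, ‖b j‖) * Real.sqrt ((1 * Fintype.card ι : ℕ) : ℝ) *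
        Real.exp (δr * F.d₀))))
    exact mul_le_mul_of_nonneg_right (mul_le_mul_of_nonneg_left hsum hpre0) hα₁.le
  have hsmall : θ * c₁' ≤ 1 / 2 := by
    have h1 : θ * c₁' ≤ Θ * c₁' * α₁ :=
      calc θ * c₁' ≤ Θ * α₁ * c₁' := mul_le_mul_of_nonneg_right hθΘ hc₁'0
        _ = Θ * c₁' * α₁ := by ring
    have h2 : Θ * c₁' * α₁ ≤ Θ * c₁' * (1 / (2 * (Θ * c₁' + 1))) := mul_le_mul_of_nonneg_left haΘ (mul_nonneg hΘ0 hc₁'0)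
    have h3 : Θ * c₁' * (1 / (2 * (Θ * c₁' + 1))) ≤ 1 / 2 := by
      rw [mul_one_div, div_le_iff₀ hden]
      have := mul_nonneg hΘ0 hc₁'0
      linarith
    linarith
  have hsmall' : θ * c₁' < 1 := by linarith
  have hMV' : HasL2Majorant (g := toB6 (geo i) (F.Rr i) (F.Hp i)) (fun p : S i × ι => F.blk i p.1)
      (F.Gop i U * conj b (vPrimeConc (F.T i) (F.coord i U) (geo i).eta (F.expA i U U') (F.blk i) (F.kQ i U) (F.kF i U U')
        (F.sQ i U) (F.sF i U U') (F.cfun i)))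
      (fun a a' => θ * Real.exp (-(49 / 50 * δr * (geo i).dist a a'))) := by
    refine hasL2Majorant_mono (g := toB6 (geo i) (F.Rr i) (F.Hp i)) _ hMV fun a a' => le_of_eq ?_
    rw [hθ]
  -- (3.65)₁ from the inverse identities; Lemma 2.1 at the walk's rate by rescaling; the two transfers are free for the constant weight
  have h365 := eq365_first_of_inverse hGΔ hinv1
  have h261w : Ineq261 (F.d261 δr) (toB6 (geo i) (F.Rr i) (F.Hp i)) ((1 - 1 / 100) * (49 / 50 * δr)) (1 / 100) :=
    ineq261_rescale (ineq261_rescale (F.h261_of i hδr hδrc hM0 (1 / 100 * (1 - 1 / 100) * (49 / 50)) (by norm_num) (by norm_num)))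
  have hT₁' : ScaleTransfer (geo i) (49 / 50 * δr) (1 / 100) 1 (fun _ => (1 : ℝ)) :=
    scaleTransfer_one (by positivity) (F.dist_nonneg i)
  have hT₂' : ScaleTransfer (geo i) ((1 - 1 / 100) * ((1 - 1 / 100) * (49 / 50 * δr))) (1 / 100) 1 (fun _ => (1 : ℝ)) :=
    scaleTransfer_one (by positivity) (F.dist_nonneg i)
  have hρ0 : 0 ≤ 49 / 50 * δr := by positivity
  -- the member-5 reading, re-associated to `G′(U) * (∇♯_k∇♯_l)` for the brick
  have hY : HasL2Majorant (g := toB6 (geo i) (F.Rr i) (F.Hp i)) (fun p : S i × ι => F.blk i p.1)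
      (F.Gop i U * (conj b (diffLetter (F.T i) (F.coord i U) ((((geo i).eta : ℂ))⁻¹) k) *
        conj b (diffLetter (F.T i) (F.coord i U) ((((geo i).eta : ℂ))⁻¹) l)))
      (fun a a' => F.cL * B₀ * (1 : ℝ) * Real.exp (-(49 / 50 * δr * (geo i).dist a a'))) := by
    rw [← mul_assoc]; exact r5ρ
  have h := hasL2Majorant_rightEntry_gpExt (R := F.Rr i) (H := F.Hp i) (fun p : S i × ι => F.blk i p.1) (F.d261 δr)
    (49 / 50 * δr) (1 / 100) (1 / 100) (1 / 100) θ (F.cL * B₀) 1 1 (fun _ => (1 : ℝ)) hBL.le zero_le_one hw0 hθ0 hρ0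
    (by norm_num) (by norm_num) (by norm_num) (F.triangle i) (F.dist_self i) (F.dist_comm i) (F.dist_nonneg i) h261w hsmall'
    hT₁' hT₂' h365 hY hMV'
  rw [← hG, ← mul_assoc] at h
  have hfactor : F.cL * B₀ * 1 * c₁' * (1 - θ * c₁')⁻¹ * 1 ≤ F.cL * B₀ * 1 * c₁' * 2 * 1 := by
    have hpos : 0 < 1 - θ * c₁' := by linarith
    have : (1 - θ * c₁')⁻¹ ≤ 2 := by
      rw [inv_le_comm₀ hpos (by norm_num : (0 : ℝ) < 2)]; linarith
    have h0 : 0 ≤ F.cL * B₀ * 1 * c₁' := by positivity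
    exact mul_le_mul_of_nonneg_right (mul_le_mul_of_nonneg_left this h0) zero_le_one
  refine hasL2Majorant_mono (g := toB6 (geo i) (F.Rr i) (F.Hp i)) _ h fun a a' => ?_
  have he : 0 ≤ (1 : ℝ) * Real.exp (-(rateR δr * (geo i).dist a a')) := mul_nonneg zero_le_one (Real.exp_nonneg _)
  calc F.cL * B₀ * 1 * B6.c1 (F.d261 δr) ((1 - 1 / 100) * (49 / 50 * δr)) (1 / 100) *
        (1 - θ * B6.c1 (F.d261 δr) ((1 - 1 / 100) * (49 / 50 * δr)) (1 / 100))⁻¹ * 1 * (1 : ℝ) *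
        Real.exp (-((1 - 1 / 100) * ((1 - 1 / 100) * ((1 - 1 / 100) * (49 / 50 * δr))) * (geo i).dist a a'))
      = (F.cL * B₀ * 1 * c₁' * (1 - θ * c₁')⁻¹ * 1) * ((1 : ℝ) * Real.exp (-(rateR δr * (geo i).dist a a'))) := by
        rw [hc₁', rateR]; ring
    _ ≤ (F.cL * B₀ * 1 * c₁' * 2 * 1) * ((1 : ℝ) * Real.exp (-(rateR δr * (geo i).dist a a'))) :=
        mul_le_mul_of_nonneg_right hfactor he
    _ = _ := by ring

/-- ★★ **THE (3.46)₅-STEP OF SECT. B FOR G′(U′U) (`‖hG′(U′U)∇*_U∇*_Uλ‖`), INHABITED AT THE LETTERS, KERNEL-FREE**: every `L2Frame₂` together with the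
`L²` READINGS at U of member 2 (`readL2_2`) and member 5 (`readL2_5`, per pair of concrete difference letters) and the WRITING of member 5 at U′U
(`writeL2_5`: block-ℓ² majorants of every `G′(U′U)∇♯_k∇♯_l` at `(B, ρ)` ⇒ the member n = 5 of the family at U′U with the frame's writing
functions `(wL B ρ, wLδ ρ)`) inhabits `B9SectBStepWhole.StepL2nPos d c35 geo bg Gp GA Cinv Gp 5` (output at `ρ″ = rateR (rate δ₀)`) — the last
of the six G′ member-steps `B9SectBStepFrameV2.SectBFrame₂` displays, framed from print's own inputs ((3.46) at U, (3.60)–(3.65), [4] Lemma 2.1,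
p. 398's convention).
[cite: Balaban1985BackgroundPropagators, Thm 3.4 p.400 + Thm 3.1 (3.46) p.398 + p.398 (remarks) + (3.60)–(3.65) p.402 + p.403 l.1–9; Balaban1984PropagatorsII, Prop. 2.6 (2.140)–(2.141) p.247 + Lemma 2.1 p.234] -/
theorem stepL2nPos_five_of_l2Frame₂ (F : L2Frame₂ c35 geo bg Gp b κ S)
    (readL2_2 : ∀ i (α₀ : ℝ) (U : (bg i).Cfg) (B₀ δ : ℝ), F.MInv ≤ (geo i).M → 0 < α₀ → (geo i).M * α₀ ≤ F.aInv →
      (bg i).Reg335 c35 α₀ U → 0 < B₀ → 0 < δ → L2Block (Gp i) B₀ δ U →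
      ∀ k : κ ⊕ κ, HasL2Majorant (g := toB6 (geo i) (F.Rr i) (F.Hp i)) (fun p : S i × ι => F.blk i p.1)
        (F.Gop i U * conj b (diffLetter (F.T i) (F.coord i U) ((((geo i).eta : ℂ))⁻¹) k))
        (fun a a' => F.cL * B₀ * (geo i).len a * Real.exp (-(δ * (geo i).dist a a'))))
    (readL2_5 : ∀ i (α₀ : ℝ) (U : (bg i).Cfg) (B₀ δ : ℝ), F.MInv ≤ (geo i).M → 0 < α₀ → (geo i).M * α₀ ≤ F.aInv →
      (bg i).Reg335 c35 α₀ U → 0 < B₀ → 0 < δ → L2Block (Gp i) B₀ δ U →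
      ∀ k l : κ ⊕ κ, HasL2Majorant (g := toB6 (geo i) (F.Rr i) (F.Hp i)) (fun p : S i × ι => F.blk i p.1)
        (F.Gop i U * conj b (diffLetter (F.T i) (F.coord i U) ((((geo i).eta : ℂ))⁻¹) k) *
          conj b (diffLetter (F.T i) (F.coord i U) ((((geo i).eta : ℂ))⁻¹) l))
        (fun a a' => F.cL * B₀ * 1 * Real.exp (-(δ * (geo i).dist a a'))))
    (writeL2_5 : ∀ i (U U' : (bg i).Cfg) (α₁ B δ : ℝ), 0 < α₁ → α₁ ≤ F.aW → (bg i).Cplx337 α₁ U U' → 0 ≤ B → 0 < δ →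
      (∀ k l : κ ⊕ κ, HasL2Majorant (g := toB6 (geo i) (F.Rr i) (F.Hp i)) (fun p : S i × ι => F.blk i p.1)
          (F.Gop i ((bg i).mul U' U) * conj b (diffLetter (F.T i) (F.coord i U) ((((geo i).eta : ℂ))⁻¹) k) *
            conj b (diffLetter (F.T i) (F.coord i U) ((((geo i).eta : ℂ))⁻¹) l))
          (fun a a' => B * 1 * Real.exp (-(δ * (geo i).dist a a')))) →
      ∀ (lam : (geo i).Loc) (h : (geo i).Cut) (y y' : (geo i).Site), (geo i).cutIn h y → (geo i).suppIn lam y' →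
        (Gp i).l2 5 ((bg i).mul U' U) lam h ≤
          F.wL B δ * B9.pref6 ((geo i).len y) 5 * (geo i).cutSup h * Real.exp (-(F.wLδ δ * (geo i).dist y y')) *
            (geo i).l2Norm lam)
    (GA : ∀ i, B9.KernelFamily (geo i) (bg i)) (Cinv : ∀ i, B9.SiteKernel (geo i) (bg i)) :
    StepL2nPos d c35 geo bg Gp GA Cinv Gp 5 := by
  intro B₀ δ₀ Bβ Bε Bεβ B₁ δ₁ hB₀ hδ₀ _ _
  obtain ⟨a₁, ha₁, B, hB, Hc⟩ := l2secondRightEntries_ext_of_l2Frame₂ F readL2_2 readL2_5 hB₀ hδ₀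
  have hρ' : 0 < rateR (F.rate δ₀) := rateR_pos (F.rate_pos hδ₀)
  refine ⟨F.Mthr (F.rate δ₀), min a₁ F.aW, F.aInv, (F.wL B (rateR (F.rate δ₀)), F.wLδ (rateR (F.rate δ₀))), F.Mthr_pos _,
    lt_min ha₁ F.aW_pos, F.aInv_pos, ⟨F.wL_pos B _ hB hρ', F.wLδ_pos _ hρ'⟩, ?_⟩
  intro i hM0 α₀ hα₀ hMa U hU hT α₁ hα₁ ha U' hU' lam h y y' hcut hs
  have e5 := Hc i α₀ U hM0 hα₀ hMa hU hT.1.1.1 hT.1.1.2.1 α₁ U' hα₁ (le_trans ha (min_le_left _ _)) hU'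
  exact writeL2_5 i U U' α₁ B _ hα₁ (le_trans ha (min_le_right _ _)) hU' hB hρ' e5 lam h y y' hcut hs

end Literature.MathematicalPhysics.QuantumFieldTheory.Balaban1983to89.B9SectBL2StepAtLettersV2Second
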